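import Mathlib
import Summits.NavierStokesRegularity.NavierStokesRegularity.Theorems.FilamentSkeletonRssClause13LowSliceForm

/-!
# Clause 13-J, brick B4 (S3/S4 side): HIGH-SLICE COERCIVITY of the model self form
# `(2/q)‖f‖² − ⟨K_q∗f, f⟩ ≥ (2/q)(1 − 5e^{−b/2})‖f‖²` for `f` Fourier-supported in `|z|√q ≥ b`

Route `FilamentSkeletonRss`, child `Clause13NearStraightL` (stmt-NavierStokesRegularity-23321; typing-agnostic, valid verbatim for the A1G
twin 28296); design of record `filament-plan/DESIGN-NOTE-28296-tenure-g22.md` §5 (slices S3 = mid `[1.5, C log Γ]` "symbol ≥ cG" and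
S4 = beyond).  Companion of the low-slice gain (`spectralForm_le_of_lowSlice`, p669628) with the opposite sign: from the symbol
saturation `0 ≤ 1 − 𝔖(x) ≤ 5e^{−x/2}` (`one_sub_liaSym_le_exp`, p662338) the symbol is `≥ 1 − 5e^{−b/2}` on `|x| ≥ b`, hence for
`f ∈ L¹ ∩ L²` whose un-normalised transform `F(z) = ∫ f(x)e^{izx}dx` vanishes on `|z|√q < b` (`b > 0`):

  `(2/q)(1 − 5e^{−b/2}) · ∫‖f‖² ≤ (1/2π) ∫ (2/q)𝔖(z√q)|F(z)|² dz = Re[(2/q)∫conj f·f − ∫∫K_q f conj f]`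

— a positive lower bound as soon as `b > 2 log 5 ≈ 3.22` (e.g. `≥ 0.32·(2/q)‖f‖²` for `b ≥ 4`).  The band `[0.8, 1.5]` and the
window `[1.5, 3.3]` are NOT covered by this analytic bound (virial / certified numerics territory, bricks B5 / p656939).
Lane ns-filament-19175-p1 g14; `--supports stmt-NavierStokesRegularity-23321 --as helper`.
HONEST FRAMING: harmonic analysis of an explicit model operator attached to a HYPOTHETICAL filament skeleton on the NEGATIVE side of a
MODEL route; nothing here bears on Navier–Stokes regularity or blow-up.
-/

noncomputable section

open MeasureTheory Real Complex Filter Set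
open scoped FourierTransform ComplexConjugate
open Summit.NavierStokesRegularity.NavierStokesRegularity.Theorems.AnalyticStripLiaSymbol (liaSym liaSym_neg liaSym_zero
  one_sub_liaSym_nonneg one_sub_liaSym_le_exp)

namespace Summit.NavierStokesRegularity.NavierStokesRegularity.Theorems.MatchedKernel
set_option linter.dupNamespace false

/-- Symbol floor on a high slice: for `0 < b ≤ |x|`, `1 − 5e^{−b/2} ≤ 𝔖(x)`. [folklore] -/
theorem liaSym_ge_of_mem_highSlice {b x : ℝ} (hb : 0 < b) (hbx : b ≤ |x|) :
    1 - 5 * Real.exp (-(b / 2)) ≤ liaSym x := by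
  have hx0 : 0 < |x| := lt_of_lt_of_le hb hbx
  have heven : liaSym x = liaSym |x| := by
    rcases le_or_gt 0 x with h | h
    · rw [abs_of_nonneg h]
    · rw [abs_of_neg h, liaSym_neg]
  rw [heven]
  have h1 := one_sub_liaSym_le_exp |x| hx0
  have h2 : Real.exp (-(|x| / 2)) ≤ Real.exp (-(b / 2)) := Real.exp_le_exp.2 (by linarith)
  linarith

/-- **HIGH-SLICE COERCIVITY (spectral side).**  If `F(z) = ∫ f(x)e^{izx}dx` (`f ∈ L¹ ∩ L²`) vanishes on `|z|√q < b` (`b > 0`,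
`q > 0`), then `(2/q)(1 − 5e^{−b/2})·∫‖f‖² ≤ (1/2π)∫(2/q)𝔖(z√q)|F(z)|²dz`. [folklore] -/
theorem spectralForm_ge_of_highSlice {q b : ℝ} (hq : 0 < q) (hb : 0 < b) {f : ℝ → ℂ}
    (hf : Integrable f) (hf2 : MemLp f 2)
    (hsupp : ∀ z : ℝ, |z| * √q < b → ∫ x : ℝ, f x * cexp (I * z * x) = 0) :
    2 / q * (1 - 5 * Real.exp (-(b / 2))) * ∫ t : ℝ, ‖f t‖ ^ 2
      ≤ 1 / (2 * π) * ∫ z : ℝ, (2 / q * liaSym (z * √q)) * ‖∫ x : ℝ, f x * cexp (I * z * x)‖ ^ 2 := by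
  set F : ℝ → ℂ := fun z => ∫ x : ℝ, f x * cexp (I * z * x) with hFdef
  have hsq : 0 < √q := Real.sqrt_pos.2 hq
  have hpt : ∀ z : ℝ, (2 / q * (1 - 5 * Real.exp (-(b / 2)))) * ‖F z‖ ^ 2 ≤ (2 / q * liaSym (z * √q)) * ‖F z‖ ^ 2 := by
    intro z
    by_cases hz : b ≤ |z| * √q
    · have hx : b ≤ |z * √q| := by rw [abs_mul, abs_of_pos hsq]; exact hz
      exact mul_le_mul_of_nonneg_right (mul_le_mul_of_nonneg_left (liaSym_ge_of_mem_highSlice hb hx) (by positivity))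
        (by positivity)
    · have hF0 : F z = 0 := hsupp z (lt_of_not_ge hz)
      simp [hF0]
  have hI2 : Integrable (fun z : ℝ => ‖F z‖ ^ 2) := integrable_norm_sq_unnormalisedTransform hf hf2
  have hIl : Integrable (fun z : ℝ => (2 / q * (1 - 5 * Real.exp (-(b / 2)))) * ‖F z‖ ^ 2) := hI2.const_mul _
  have hIr : Integrable (fun z : ℝ => (2 / q * liaSym (z * √q)) * ‖F z‖ ^ 2) := by
    refine hI2.bdd_mul (c := 2 / q * 4) ?_ (Eventually.of_forall fun z => ?_)
    · exact ((continuous_const.mul (continuous_liaSym.comp (continuous_id.mul continuous_const))).aestronglyMeasurable)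
    · rw [Real.norm_eq_abs, abs_mul, abs_of_pos (by positivity : (0:ℝ) < 2 / q)]
      exact mul_le_mul_of_nonneg_left (abs_liaSym_le_four _) (by positivity)
  have hmono : ∫ z : ℝ, (2 / q * (1 - 5 * Real.exp (-(b / 2)))) * ‖F z‖ ^ 2 ≤ ∫ z : ℝ, (2 / q * liaSym (z * √q)) * ‖F z‖ ^ 2 :=
    integral_mono hIl hIr hpt
  rw [integral_const_mul] at hmono
  have hplanch : 1 / (2 * π) * ∫ z : ℝ, ‖F z‖ ^ 2 = ∫ t : ℝ, ‖f t‖ ^ 2 := by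
    rw [← Literature.Analysis.FunctionSpaces.integral_norm_sq_fourierIntegral_eq hf hf2,
      integral_norm_sq_fourier_eq_unnormalised]
  have hpos : (0 : ℝ) < 1 / (2 * π) := by positivity
  calc 2 / q * (1 - 5 * Real.exp (-(b / 2))) * ∫ t : ℝ, ‖f t‖ ^ 2
      = 1 / (2 * π) * ((2 / q * (1 - 5 * Real.exp (-(b / 2)))) * ∫ z : ℝ, ‖F z‖ ^ 2) := by rw [← hplanch]; ring
    _ ≤ 1 / (2 * π) * ∫ z : ℝ, (2 / q * liaSym (z * √q)) * ‖F z‖ ^ 2 := mul_le_mul_of_nonneg_left hmono hpos.le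

/-- **HIGH-SLICE COERCIVITY for the model self operator `M_q = (2/q)·I − K_q∗`**: for `f ∈ L¹ ∩ L²` whose un-normalised transform
vanishes on `|z|√q < b`, `(2/q)(1 − 5e^{−b/2})·∫‖f‖² ≤ Re[(2/q)∫conj f·f − ∫∫K_q(t−u) f(u) conj f(t)]`. [folklore] -/
theorem modelSelfForm_re_ge_of_highSlice {q b : ℝ} (hq : 0 < q) (hb : 0 < b) {f : ℝ → ℂ}
    (hf : Integrable f) (hf2 : MemLp f 2)
    (hsupp : ∀ z : ℝ, |z| * √q < b → ∫ x : ℝ, f x * cexp (I * z * x) = 0) :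
    2 / q * (1 - 5 * Real.exp (-(b / 2))) * ∫ t : ℝ, ‖f t‖ ^ 2
      ≤ ((2 / q : ℂ) * (∫ t : ℝ, conj (f t) * f t)
        - ∫ t : ℝ, ∫ u : ℝ, ((((2 * q - (t - u) ^ 2) * (((t - u) ^ 2 + q) ^ (5 / 2 : ℝ))⁻¹ : ℝ)) : ℂ) * f u * conj (f t)).re := by
  rw [modelSelfForm_eq_spectral hq hf hf2, Complex.ofReal_re]
  exact spectralForm_ge_of_highSlice hq hb hf hf2 hsupp

/-- Numerical corollary: for `b ≥ 4` the coercivity constant is at least `(2/q)·(8/25)` (`1 − 5e^{−2} ≥ 0.32`). [folklore] -/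
theorem highSlice_constant_ge (b : ℝ) (hb : 4 ≤ b) : 8 / 25 ≤ 1 - 5 * Real.exp (-(b / 2)) := by
  have h1 : Real.exp (-(b / 2)) ≤ Real.exp (-2) := Real.exp_le_exp.2 (by linarith)
  -- `e^{-2} ≤ 0.136`: from `e ≥ 2.7182818283` ⇒ `e² ≥ 7.389` ⇒ `e^{-2} ≤ 1/7.389 < 0.136`
  have he : Real.exp 2 = Real.exp 1 * Real.exp 1 := by rw [← Real.exp_add]; norm_num
  have h2 : (7.389 : ℝ) ≤ Real.exp 2 := by
    rw [he]; nlinarith [Real.exp_one_gt_d9, Real.exp_pos 1]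
  have h3 : Real.exp (-2) ≤ 1 / 7.389 := by
    rw [Real.exp_neg, ← one_div]
    exact one_div_le_one_div_of_le (by norm_num) h2
  nlinarith

end Summit.NavierStokesRegularity.NavierStokesRegularity.Theorems.MatchedKernel

end
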